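import Summits.NavierStokesRegularity.NavierStokesRegularity.Theorems.HodographBetchovClassBudgetsRegulariseSlice

/-!
# Crux `HodographBetchov.FastClassSqueeze` — velocity-truncated enstrophy, the cut-off
# integration by parts of the production

Helper file for the crux item stmt-NavierStokesRegularity-15832 (`FastClassSqueeze`, route
`HodographBetchov` of `NavierStokesRegularity`). For one time slice `v` of a classical solution in
Tao's class (`v ∈ C³` bounded with bounded gradient, `Dv, D²v ∈ L²`), `ω = curl v`, the production
density `P = ⟪ω, ∇v ω⟫`, and a `C¹` cut-off `χ : ℝ → ℝ` with `χ, χ'` bounded, applied to the SPEED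
(`φ = χ(‖v‖²)`):

  `∫ χ(‖v‖²) P = −∫ χ(‖v‖²) ⟪v, ∇ω ω⟫ − ∫ ⟪v, ω⟫ χ'(‖v‖²) 2⟪v, ∇v ω⟫`
  (`integral_cutoff_mul_production_eq`)

— the `L¹` divergence theorem (`integral_mul_divergence_add_eq_zero_of_integrable`) for the field
`φ ⟪v, ω⟫ ω`, whose divergence is `φ P + φ ⟪v, ∇ω ω⟫ + ⟪v, ω⟫ ⟪∇φ, ω⟫` (`div ω = 0`). On the
slow class the velocity factor `v` is bounded by the cut-off level, so the first term is paid by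
the dissipation; the second (shell) term lives on the fast class. This is the identity that makes
the slow-class production budget of the route DISPENSABLE (file `…StreamStrainSlice.lean`).

References: L. C. Evans, *Partial Differential Equations* (2010), App. C.2; A. J. Majda,
A. L. Bertozzi, *Vorticity and Incompressible Flow* (2002), §1.2.
-/

noncomputable section

open MeasureTheory Set Function Filter Topology InnerProductSpace
open scoped ENNReal NNReal ContDiff RealInnerProductSpace

-- the summit and its single sub-problem share the name (CONVENTIONS §1), as in every Theorems file
set_option linter.dupNamespace false

namespace Summit.NavierStokesRegularity.NavierStokesRegularity.Theorems.FastClassSqueeze.StreamStrain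

open Literature.Analysis Literature.Analysis.FluidPDE
open Summit.NavierStokesRegularity.NavierStokesRegularity.Theorems.ClassBudgetsRegularise

/-- The derivative of the speed cut-off `φ = χ(‖v‖²)` along `h`:
`Dφ(x) h = χ'(‖v x‖²) · 2⟪v x, Dv(x) h⟫`. [folklore] -/
theorem fderiv_cutoff_normSq_apply {v : EuclideanSpace ℝ (Fin 3) → EuclideanSpace ℝ (Fin 3)}
    (hv : ContDiff ℝ 1 v) {χ : ℝ → ℝ} (hχ : ContDiff ℝ 1 χ) (x h : EuclideanSpace ℝ (Fin 3)) :
    fderiv ℝ (fun y => χ (‖v y‖ ^ 2)) x h = deriv χ (‖v x‖ ^ 2) * (2 * ⟪v x, fderiv ℝ v x h⟫) := by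
  have hvd : HasFDerivAt v (fderiv ℝ v x) x := (hv.differentiable one_ne_zero x).hasFDerivAt
  have hsq : HasFDerivAt (fun y => ‖v y‖ ^ 2) (2 • (innerSL ℝ (v x)).comp (fderiv ℝ v x)) x :=
    hvd.norm_sq
  have hχd : HasDerivAt χ (deriv χ (‖v x‖ ^ 2)) (‖v x‖ ^ 2) :=
    ((hχ.differentiable one_ne_zero) _).hasDerivAt
  have hcomp : HasFDerivAt (fun y => χ (‖v y‖ ^ 2))
      (deriv χ (‖v x‖ ^ 2) • ((2 : ℕ) • (innerSL ℝ (v x)).comp (fderiv ℝ v x))) x :=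
    hχd.comp_hasFDerivAt x hsq
  rw [hcomp.fderiv]
  simp [two_mul, mul_add, smul_eq_mul]

/-- The derivative of the helicity-type density `⟪v, ω⟫`, `ω = curl v`, along `h`:
`D⟪v, ω⟫(x) h = ⟪Dv(x) h, ω⟫ + ⟪v, Dω(x) h⟫`. [folklore] -/
theorem fderiv_inner_curl_apply {v : EuclideanSpace ℝ (Fin 3) → EuclideanSpace ℝ (Fin 3)}
    (hv : ContDiff ℝ 2 v) (x h : EuclideanSpace ℝ (Fin 3)) :
    fderiv ℝ (fun y => ⟪v y, curl v y⟫) x h =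
      ⟪fderiv ℝ v x h, curl v x⟫ + ⟪v x, fderiv ℝ (curl v) x h⟫ := by
  have hvd : HasFDerivAt v (fderiv ℝ v x) x := (hv.differentiable (by norm_num) x).hasFDerivAt
  have hω1 : ContDiff ℝ 1 (curl v) := contDiff_curl (n := 1) (by exact_mod_cast hv)
  have hωd : HasFDerivAt (curl v) (fderiv ℝ (curl v) x) x :=
    (hω1.differentiable one_ne_zero x).hasFDerivAt
  rw [(hvd.inner ℝ hωd).fderiv]
  simp only [ContinuousLinearMap.coe_comp, comp_apply, ContinuousLinearMap.prod_apply,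
    fderivInnerCLM_apply]
  rw [add_comm, real_inner_comm (curl v x)]

/-- **The cut-off integration by parts of the production.** For `v ∈ C³(ℝ³; ℝ³)` bounded with
bounded gradient and `Dv, D²v ∈ L²`, `ω = curl v`, and a cut-off `χ ∈ C¹(ℝ)` with `|χ| ≤ M`,
`|χ'| ≤ D`:
`∫ χ(‖v‖²) ⟪ω, ∇v ω⟫ = −∫ χ(‖v‖²) ⟪v, ∇ω ω⟫ − ∫ ⟪v, ω⟫ χ'(‖v‖²) 2 ⟪v, ∇v ω⟫`.
Proof: the `L¹` divergence theorem for `θ ω`, `θ = χ(‖v‖²) ⟪v, ω⟫` (`div ω = 0`,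
`⟪ω, ∇θ⟫ = ⟪v, ω⟫ χ' 2⟪v, ∇v ω⟫ + χ (⟪∇v ω, ω⟫ + ⟪v, ∇ω ω⟫)`); every term is continuous and
bounded by a product of two `L²` functions. [cite: Evans2010, App. C.2 Thm. 1–2] -/
theorem integral_cutoff_mul_production_eq
    {v : EuclideanSpace ℝ (Fin 3) → EuclideanSpace ℝ (Fin 3)} (hv : ContDiff ℝ 3 v)
    {B : ℝ} (hB : ∀ x, ‖v x‖ ≤ B) {K : ℝ} (hK : ∀ x, ‖fderiv ℝ v x‖ ≤ K)
    (hv1 : ∫⁻ x, ‖iteratedFDeriv ℝ 1 v x‖ₑ ^ 2 < ⊤) (hv2 : ∫⁻ x, ‖iteratedFDeriv ℝ 2 v x‖ₑ ^ 2 < ⊤)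
    {χ : ℝ → ℝ} (hχ : ContDiff ℝ 1 χ) {M : ℝ} (hχM : ∀ s, |χ s| ≤ M) {D : ℝ}
    (hχD : ∀ s, |deriv χ s| ≤ D) :
    ∫ x, χ (‖v x‖ ^ 2) * ⟪curl v x, fderiv ℝ v x (curl v x)⟫ =
      -(∫ x, χ (‖v x‖ ^ 2) * ⟪v x, fderiv ℝ (curl v) x (curl v x)⟫) -
        ∫ x, ⟪v x, curl v x⟫ * (deriv χ (‖v x‖ ^ 2) * (2 * ⟪v x, fderiv ℝ v x (curl v x)⟫)) := by
  have hB0 : 0 ≤ B := (norm_nonneg _).trans (hB 0)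
  have hK0 : 0 ≤ K := (norm_nonneg _).trans (hK 0)
  have hM0 : 0 ≤ M := (abs_nonneg _).trans (hχM 0)
  have hD0 : 0 ≤ D := (abs_nonneg _).trans (hχD 0)
  have hv2' : ContDiff ℝ 2 v := hv.of_le (by norm_num)
  have hv1' : ContDiff ℝ 1 v := hv.of_le (by norm_num)
  have hω2 : ContDiff ℝ 2 (curl v) := contDiff_curl (n := 2) (by exact_mod_cast hv)
  have hω1 : ContDiff ℝ 1 (curl v) := hω2.of_le (by norm_num)
  -- the scalar `θ = φ ⟪v, ω⟫`
  set φ : EuclideanSpace ℝ (Fin 3) → ℝ := fun y => χ (‖v y‖ ^ 2) with hφ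
  have hφ1 : ContDiff ℝ 1 φ := hχ.comp (hv1'.norm_sq ℝ)
  have hhel1 : ContDiff ℝ 1 fun y => ⟪v y, curl v y⟫ := hv1'.inner ℝ hω1
  set θ : EuclideanSpace ℝ (Fin 3) → ℝ := fun y => φ y * ⟪v y, curl v y⟫ with hθ
  have hθ1 : ContDiff ℝ 1 θ := hφ1.mul hhel1
  -- continuity
  have cv : Continuous v := hv.continuous
  have cDv : Continuous (fderiv ℝ v) := hv.continuous_fderiv (by norm_num)
  have cω : Continuous (curl v) := hω1.continuous
  have cDω : Continuous (fderiv ℝ (curl v)) := hω1.continuous_fderiv one_ne_zero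
  have cφ : Continuous φ := hφ1.continuous
  have cχ' : Continuous fun y => deriv χ (‖v y‖ ^ 2) :=
    (hχ.continuous_deriv le_rfl).comp (cv.norm.pow 2)
  have chel : Continuous fun x => ⟪v x, curl v x⟫ := cv.inner cω
  have cP : Continuous fun x => ⟪curl v x, fderiv ℝ v x (curl v x)⟫ := cω.inner (cDv.clm_apply cω)
  have cAω : Continuous fun x => fderiv ℝ v x (curl v x) := cDv.clm_apply cω
  have cDωω : Continuous fun x => fderiv ℝ (curl v) x (curl v x) := cDω.clm_apply cω
  have cvAω : Continuous fun x => ⟪v x, fderiv ℝ v x (curl v x)⟫ := cv.inner cAω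
  -- pointwise bounds and `L²` facts
  have hDv_eq : ∀ x, ‖fderiv ℝ v x‖ = ‖iteratedFDeriv ℝ 1 v x‖ := fun x => by
    rw [← norm_iteratedFDeriv_fderiv, norm_iteratedFDeriv_zero]
  have hDω_le : ∀ x, ‖fderiv ℝ (curl v) x‖ ≤ ‖curlCLM‖ * ‖iteratedFDeriv ℝ 2 v x‖ := by
    intro x
    have hcomp : fderiv ℝ (curl v) x = curlCLM.comp (fderiv ℝ (fderiv ℝ v) x) := by
      rw [curl_eq_curlCLM_comp]
      exact (curlCLM.hasFDerivAt.comp x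
        (((hv2'.fderiv_right (m := 1) (by norm_num)).differentiable one_ne_zero) x).hasFDerivAt).fderiv
    rw [hcomp]
    refine (ContinuousLinearMap.opNorm_comp_le _ _).trans (le_of_eq ?_)
    rw [← norm_iteratedFDeriv_zero (𝕜 := ℝ) (f := fderiv ℝ (fderiv ℝ v)), norm_iteratedFDeriv_fderiv,
      norm_iteratedFDeriv_fderiv]
  have hω_le : ∀ x, ‖curl v x‖ ≤ ‖curlCLM‖ * ‖fderiv ℝ v x‖ := fun x => norm_curl_le v x
  have hAω_le : ∀ x, ‖fderiv ℝ v x (curl v x)‖ ≤ K * ‖curl v x‖ := fun x =>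
    ((fderiv ℝ v x).le_opNorm _).trans (mul_le_mul_of_nonneg_right (hK x) (norm_nonneg _))
  have l2Dv : ∫⁻ x, ‖fderiv ℝ v x‖ₑ ^ 2 < ⊤ :=
    lintegral_enorm_sq_lt_top_of_norm_le (fun x => (hDv_eq x).le) hv1
  have l2Dv' : ∫⁻ x, ‖‖fderiv ℝ v x‖‖ₑ ^ 2 < ⊤ := by simpa only [enorm_norm] using l2Dv
  have hv2n : ∫⁻ x, ‖‖iteratedFDeriv ℝ 2 v x‖‖ₑ ^ 2 < ⊤ := by simpa only [enorm_norm] using hv2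
  have l2ω : ∫⁻ x, ‖curl v x‖ₑ ^ 2 < ⊤ := by
    have h : ∫⁻ x, ‖‖curlCLM‖ • ‖fderiv ℝ v x‖‖ₑ ^ 2 < ⊤ :=
      lintegral_enorm_sq_const_smul_lt_top ‖curlCLM‖ l2Dv'
    exact lintegral_enorm_sq_lt_top_of_norm_le (fun x => (hω_le x).trans (le_abs_self _)) h
  have l2ω' : ∫⁻ x, ‖‖curl v x‖‖ₑ ^ 2 < ⊤ := by simpa only [enorm_norm] using l2ω
  have l2Dω : ∫⁻ x, ‖fderiv ℝ (curl v) x‖ₑ ^ 2 < ⊤ := by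
    have h : ∫⁻ x, ‖‖curlCLM‖ • ‖iteratedFDeriv ℝ 2 v x‖‖ₑ ^ 2 < ⊤ :=
      lintegral_enorm_sq_const_smul_lt_top ‖curlCLM‖ hv2n
    exact lintegral_enorm_sq_lt_top_of_norm_le (fun x => (hDω_le x).trans (le_abs_self _)) h
  have l2Dω' : ∫⁻ x, ‖‖fderiv ℝ (curl v) x‖‖ₑ ^ 2 < ⊤ := by simpa only [enorm_norm] using l2Dω
  have l2c : ∀ c : ℝ, ∫⁻ x, ‖c • ‖curl v x‖‖ₑ ^ 2 < ⊤ := fun c =>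
    lintegral_enorm_sq_const_smul_lt_top c l2ω'
  have l2cD : ∀ c : ℝ, ∫⁻ x, ‖c • ‖fderiv ℝ (curl v) x‖‖ₑ ^ 2 < ⊤ := fun c =>
    lintegral_enorm_sq_const_smul_lt_top c l2Dω'
  have ca : ∀ c : ℝ, Continuous fun x => c • ‖curl v x‖ := fun c => cω.norm.const_smul c
  have caD : ∀ c : ℝ, Continuous fun x => c • ‖fderiv ℝ (curl v) x‖ := fun c => cDω.norm.const_smul c
  have hnn : ∀ {c : ℝ} (hc : 0 ≤ c) (r : ℝ) (hr : 0 ≤ r), ‖c • r‖ = c * r := by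
    intro c hc r hr
    rw [smul_eq_mul, Real.norm_of_nonneg (mul_nonneg hc hr)]
  -- the three densities `φ P`, `Q = φ ⟪v, ∇ω ω⟫`, `R = ⟪v, ω⟫ χ' 2⟪v, ∇v ω⟫` and `θ ω` are integrable
  have hφM : ∀ x, |φ x| ≤ M := fun x => hχM _
  have iP : Integrable (fun x => φ x * ⟪curl v x, fderiv ℝ v x (curl v x)⟫) volume := by
    refine integrable_of_norm_le_mul_of_lintegral_sq ((cφ.mul cP).aestronglyMeasurable)
      (ca (M * K)) cω (l2c (M * K)) l2ω fun x => ?_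
    rw [norm_mul, Real.norm_eq_abs, hnn (mul_nonneg hM0 hK0) _ (norm_nonneg _)]
    calc |φ x| * ‖⟪curl v x, fderiv ℝ v x (curl v x)⟫‖
        ≤ M * (‖curl v x‖ * ‖fderiv ℝ v x (curl v x)‖) :=
          mul_le_mul (hφM x) (norm_inner_le_norm _ _) (norm_nonneg _) hM0
      _ ≤ M * (‖curl v x‖ * (K * ‖curl v x‖)) := by gcongr; exact hAω_le x
      _ = M * K * ‖curl v x‖ * ‖curl v x‖ := by ring
  have iQ : Integrable (fun x => φ x * ⟪v x, fderiv ℝ (curl v) x (curl v x)⟫) volume := by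
    refine integrable_of_norm_le_mul_of_lintegral_sq ((cφ.mul (cv.inner cDωω)).aestronglyMeasurable)
      (caD (M * B)) cω (l2cD (M * B)) l2ω fun x => ?_
    rw [norm_mul, Real.norm_eq_abs, hnn (mul_nonneg hM0 hB0) _ (norm_nonneg _)]
    calc |φ x| * ‖⟪v x, fderiv ℝ (curl v) x (curl v x)⟫‖
        ≤ M * (‖v x‖ * ‖fderiv ℝ (curl v) x (curl v x)‖) :=
          mul_le_mul (hφM x) (norm_inner_le_norm _ _) (norm_nonneg _) hM0
      _ ≤ M * (B * (‖fderiv ℝ (curl v) x‖ * ‖curl v x‖)) := by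
          gcongr
          · exact hB x
          · exact (fderiv ℝ (curl v) x).le_opNorm _
      _ = M * B * ‖fderiv ℝ (curl v) x‖ * ‖curl v x‖ := by ring
  have iR : Integrable (fun x => ⟪v x, curl v x⟫ *
      (deriv χ (‖v x‖ ^ 2) * (2 * ⟪v x, fderiv ℝ v x (curl v x)⟫))) volume := by
    refine integrable_of_norm_le_mul_of_lintegral_sq
      ((chel.mul (cχ'.mul (cvAω.const_mul 2))).aestronglyMeasurable)
      (ca (B * (D * (2 * (B * K))))) cω (l2c _) l2ω fun x => ?_
    rw [norm_mul, norm_mul, norm_mul, Real.norm_eq_abs, Real.norm_eq_abs, Real.norm_eq_abs,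
      Real.norm_eq_abs, hnn (by positivity) _ (norm_nonneg _), abs_two]
    have h1 : |⟪v x, curl v x⟫| ≤ B * ‖curl v x‖ :=
      (abs_real_inner_le_norm _ _).trans (mul_le_mul_of_nonneg_right (hB x) (norm_nonneg _))
    have h2 : |⟪v x, fderiv ℝ v x (curl v x)⟫| ≤ B * K * ‖curl v x‖ := by
      calc |⟪v x, fderiv ℝ v x (curl v x)⟫| ≤ ‖v x‖ * ‖fderiv ℝ v x (curl v x)‖ :=
            abs_real_inner_le_norm _ _
        _ ≤ B * (K * ‖curl v x‖) := mul_le_mul (hB x) (hAω_le x) (norm_nonneg _) hB0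
        _ = B * K * ‖curl v x‖ := by ring
    calc |⟪v x, curl v x⟫| * (|deriv χ (‖v x‖ ^ 2)| * (2 * |⟪v x, fderiv ℝ v x (curl v x)⟫|))
        ≤ (B * ‖curl v x‖) * (D * (2 * (B * K * ‖curl v x‖))) := by
          gcongr
          exact hχD _
      _ = B * (D * (2 * (B * K))) * ‖curl v x‖ * ‖curl v x‖ := by ring
  have iθω : Integrable (fun x => θ x • curl v x) volume := by
    refine integrable_of_norm_le_mul_of_lintegral_sq ((hθ1.continuous.smul cω).aestronglyMeasurable)
      (ca (M * B)) cω (l2c (M * B)) l2ω fun x => ?_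
    rw [norm_smul, hnn (mul_nonneg hM0 hB0) _ (norm_nonneg _), hθ]
    simp only [norm_mul, Real.norm_eq_abs]
    have h1 : |⟪v x, curl v x⟫| ≤ B * ‖curl v x‖ :=
      (abs_real_inner_le_norm _ _).trans (mul_le_mul_of_nonneg_right (hB x) (norm_nonneg _))
    calc |φ x| * |⟪v x, curl v x⟫| * ‖curl v x‖ ≤ M * (B * ‖curl v x‖) * ‖curl v x‖ := by
          gcongr
          exact hφM x
      _ = M * B * ‖curl v x‖ * ‖curl v x‖ := by ring
  -- the derivative of `θ` along `ω`
  have hDθ : ∀ x, fderiv ℝ θ x (curl v x) =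
      φ x * ⟪curl v x, fderiv ℝ v x (curl v x)⟫ + φ x * ⟪v x, fderiv ℝ (curl v) x (curl v x)⟫ +
        ⟪v x, curl v x⟫ * (deriv χ (‖v x‖ ^ 2) * (2 * ⟪v x, fderiv ℝ v x (curl v x)⟫)) := by
    intro x
    have hdφ : DifferentiableAt ℝ φ x := (hφ1.differentiable one_ne_zero) x
    have hdh : DifferentiableAt ℝ (fun y => ⟪v y, curl v y⟫) x := (hhel1.differentiable one_ne_zero) x
    rw [hθ, fderiv_fun_mul hdφ hdh]
    simp only [add_apply, FunLike.coe_smul, Pi.smul_apply, smul_eq_mul]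
    rw [fderiv_inner_curl_apply hv2', hφ, fderiv_cutoff_normSq_apply hv1' hχ,
      real_inner_comm (curl v x)]
    ring
  have hgradθ : ∀ x, ⟪curl v x, gradient θ x⟫ = fderiv ℝ θ x (curl v x) := by
    intro x
    rw [real_inner_comm, gradient, InnerProductSpace.toDual_symm_apply]
  -- the `L¹` divergence theorem
  have hdivω : ∀ x, VectorCalculus.divergence (curl v) x = 0 := fun x =>
    divergence_curl_eq_zero_holds v hv2' x
  have h₁ : Integrable (fun x => θ x * VectorCalculus.divergence (curl v) x) volume := by
    have : (fun x => θ x * VectorCalculus.divergence (curl v) x) = fun _ => 0 := by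
      funext x; rw [hdivω x, mul_zero]
    rw [this]; exact integrable_zero _ _ _
  have hsum : Integrable (fun x => φ x * ⟪curl v x, fderiv ℝ v x (curl v x)⟫ +
      φ x * ⟪v x, fderiv ℝ (curl v) x (curl v x)⟫ +
        ⟪v x, curl v x⟫ * (deriv χ (‖v x‖ ^ 2) * (2 * ⟪v x, fderiv ℝ v x (curl v x)⟫))) volume :=
    (iP.add iQ).add iR
  have h₂ : Integrable (fun x => ⟪curl v x, gradient θ x⟫) volume := by
    refine hsum.congr (Eventually.of_forall fun x => ?_)
    simp only
    rw [hgradθ, hDθ]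
  have key := integral_mul_divergence_add_eq_zero_of_integrable hθ1 hω1 iθω h₁ h₂
  have h0 : ∫ x, θ x * VectorCalculus.divergence (curl v) x = 0 := by
    simp_rw [hdivω, mul_zero, integral_zero]
  rw [h0, zero_add] at key
  have hkey : ∫ x, (φ x * ⟪curl v x, fderiv ℝ v x (curl v x)⟫ +
      φ x * ⟪v x, fderiv ℝ (curl v) x (curl v x)⟫ +
        ⟪v x, curl v x⟫ * (deriv χ (‖v x‖ ^ 2) * (2 * ⟪v x, fderiv ℝ v x (curl v x)⟫))) = 0 := by
    rw [← key]
    refine integral_congr_ae (Eventually.of_forall fun x => ?_)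
    simp only
    rw [hgradθ, hDθ]
  rw [integral_add (f := fun x => φ x * ⟪curl v x, fderiv ℝ v x (curl v x)⟫ +
      φ x * ⟪v x, fderiv ℝ (curl v) x (curl v x)⟫)
      (g := fun x => ⟪v x, curl v x⟫ * (deriv χ (‖v x‖ ^ 2) * (2 * ⟪v x, fderiv ℝ v x (curl v x)⟫)))
      (iP.add iQ) iR,
    integral_add iP iQ] at hkey
  have : ∫ x, φ x * ⟪curl v x, fderiv ℝ v x (curl v x)⟫ =
      -(∫ x, φ x * ⟪v x, fderiv ℝ (curl v) x (curl v x)⟫) -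
        ∫ x, ⟪v x, curl v x⟫ * (deriv χ (‖v x‖ ^ 2) * (2 * ⟪v x, fderiv ℝ v x (curl v x)⟫)) := by
    linarith
  exact this

/-- **The cut-off integration by parts of the production, registered helper-stub form** (the
`∀`-closed statement of `integral_cutoff_mul_production_eq`). [cite: Evans2010, App. C.2 Thm. 1–2] -/
theorem cutoff_production_ibp :
    ∀ (v : EuclideanSpace ℝ (Fin 3) → EuclideanSpace ℝ (Fin 3)), ContDiff ℝ 3 v →
      (∃ B : ℝ, ∀ x, ‖v x‖ ≤ B) → (∃ K : ℝ, ∀ x, ‖fderiv ℝ v x‖ ≤ K) →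
      (∫⁻ x, ‖iteratedFDeriv ℝ 1 v x‖ₑ ^ 2 < ⊤) → (∫⁻ x, ‖iteratedFDeriv ℝ 2 v x‖ₑ ^ 2 < ⊤) →
      ∀ (χ : ℝ → ℝ), ContDiff ℝ 1 χ → (∃ M : ℝ, ∀ s, |χ s| ≤ M) → (∃ D : ℝ, ∀ s, |deriv χ s| ≤ D) →
      ∫ x, χ (‖v x‖ ^ 2) * inner ℝ (Literature.Analysis.FluidPDE.curl v x)
          (fderiv ℝ v x (Literature.Analysis.FluidPDE.curl v x)) =
        -(∫ x, χ (‖v x‖ ^ 2) * inner ℝ (v x)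
            (fderiv ℝ (Literature.Analysis.FluidPDE.curl v) x (Literature.Analysis.FluidPDE.curl v x))) -
          ∫ x, inner ℝ (v x) (Literature.Analysis.FluidPDE.curl v x) * (deriv χ (‖v x‖ ^ 2) *
            (2 * inner ℝ (v x) (fderiv ℝ v x (Literature.Analysis.FluidPDE.curl v x)))) := by
  intro v hv hB hK hv1 hv2 χ hχ hM hD
  obtain ⟨B, hB⟩ := hB
  obtain ⟨K, hK⟩ := hK
  obtain ⟨M, hM⟩ := hM
  obtain ⟨D, hD⟩ := hD
  exact integral_cutoff_mul_production_eq hv hB hK hv1 hv2 hχ hM hD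

end Summit.NavierStokesRegularity.NavierStokesRegularity.Theorems.FastClassSqueeze.StreamStrain

end
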